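import Summits.Ventures.PercRepro.S1CoreCapUncond
import Summits.Ventures.PercRepro.S1CoreCapBridge
import Summits.Ventures.PercRepro.RankLevelSetFiveCircuitAvg

/-!
# PercRepro — THE NULLITY-2 STRUCTURE OF THE 4-CIRCUITS: FOUR QUADS FORCE A `U₃,₅` (p8 g7, S3)

`proofs/P8-S3-NULLITY3.md`. (L1) At nullity `2`, `s₄ ≥ 4` forces two 4-circuits sharing three points; their 5-point
union `P` carries every circuit (every circuit of a nullity-`2` matroid lies in `C₁ ∪ C₂` for any two distinct circuits
`C₁, C₂` — supermodularity of the nullity) and every 4-subset of `P` is a circuit (`exists_five_of_four_le_ncard_fourCircuits`).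
(L2, L3: RankLevelSetFourCircuitNullityThree.) Such a `P` is CLOSED in a core: a point `z ∈ cl(P) ∖ P` is not `e`-free, since every partition of `E ∖ z` puts
three points of `P` on one side and they span `cl(P) ∋ z` (`closure_eq_self_of_five`). (L3) At nullity `3`, `s₄ ≥ 9`
gives, for every non-coloop `y`, `s₄(M ∖ y) ≥ 9 − Q*(3) = 4`, hence a `P_y` avoiding `y` carrying every quad avoiding
`y`; with `y₂ ∈ P_{y₁}` the quad `P_{y₁} ∖ y₂` lies in `P_{y₂} = (P_{y₁} ∖ y₂) ∪ {z}` and `z ∈ cl(P_{y₁} ∖ y₂) = P_{y₁}`,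
a contradiction: **`s₄ ≤ 8` on every `e`-free core of nullity `3`** (`ncard_fourCircuits_le_eight_of_nullity_three`;
the tree's `capKer 3 = 10`). (L4) `s₄ ≤ 16` at nullity `4` and the chain from it are in RankLevelSetFourCircuitNullityFour. Axioms: standard.
-/

open scoped Matroid

namespace PercRepro

namespace ThmN

open Set

variable {α : Type}

/-- The rank of a subset of the ground set of a finite matroid is a natural number. -/
theorem eRk_eq_nat_of_subset (M : Matroid α) [M.Finite] {X : Set α} (hX : X ⊆ M.E) :
    ∃ k : ℕ, M.eRk X = k := by
  have hfin : M.eRk X ≠ ⊤ := by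
    have h := M.eRk_le_encard X
    have : X.encard ≠ ⊤ := (M.ground_finite.subset hX).encard_lt_top.ne
    exact ne_top_of_le_ne_top this h
  obtain ⟨k, hk⟩ := ENat.ne_top_iff_exists.1 hfin
  exact ⟨k, hk.symm⟩

/-- **Two distinct circuits**: `r(C₁ ∪ C₂) + 2 ≤ |C₁ ∪ C₂|` (submodularity with the independent `C₁ ∩ C₂`). -/
theorem eRk_union_add_two_le_of_circuits (M : Matroid α) [M.Finite] {C₁ C₂ : Set α}
    (h₁ : M.IsCircuit C₁) (h₂ : M.IsCircuit C₂) (hne : C₁ ≠ C₂) {k : ℕ} (hk : M.eRk (C₁ ∪ C₂) = k) :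
    k + 2 ≤ (C₁ ∪ C₂).ncard := by
  have hf₁ : C₁.Finite := M.ground_finite.subset h₁.subset_ground
  have hf₂ : C₂.Finite := M.ground_finite.subset h₂.subset_ground
  have hI : C₁ ∩ C₂ ⊂ C₁ := by
    refine ⟨inter_subset_left, fun h => hne ?_⟩
    exact h₁.eq_of_subset_isCircuit h₂ (fun x hx => (h hx).2)
  have hind : M.Indep (C₁ ∩ C₂) := h₁.ssubset_indep hI
  have hsub := M.eRk_inter_add_eRk_union_le C₁ C₂
  rw [hind.eRk_eq_encard, hk] at hsub
  have e₁ := h₁.eRk_add_one_eq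
  have e₂ := h₂.eRk_add_one_eq
  obtain ⟨r₁, hr₁⟩ := eRk_eq_nat_of_subset M h₁.subset_ground
  obtain ⟨r₂, hr₂⟩ := eRk_eq_nat_of_subset M h₂.subset_ground
  rw [hr₁, ← hf₁.cast_ncard_eq] at e₁
  rw [hr₂, ← hf₂.cast_ncard_eq] at e₂
  rw [hr₁, hr₂, ← (hf₁.subset inter_subset_left).cast_ncard_eq] at hsub
  have hu := ncard_union_add_ncard_inter C₁ C₂ hf₁ hf₂
  have e₁' : r₁ + 1 = C₁.ncard := by exact_mod_cast e₁
  have e₂' : r₂ + 1 = C₂.ncard := by exact_mod_cast e₂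
  have hsub' : (C₁ ∩ C₂).ncard + k ≤ r₁ + r₂ := by exact_mod_cast hsub
  omega

/-- **Every circuit of a nullity-`2` matroid lies in the union of any two distinct circuits.** -/
theorem circuit_subset_union_of_nullity_two (M : Matroid α) [M.Finite] (hd : M.E.encard = M.eRank + 2)
    {C₁ C₂ C : Set α} (h₁ : M.IsCircuit C₁) (h₂ : M.IsCircuit C₂) (hne : C₁ ≠ C₂) (hC : M.IsCircuit C) :
    C ⊆ C₁ ∪ C₂ := by
  by_contra hnot
  set X := C₁ ∪ C₂ with hX
  have hXE : X ⊆ M.E := union_subset h₁.subset_ground h₂.subset_ground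
  have hfX : X.Finite := M.ground_finite.subset hXE
  have hfC : C.Finite := M.ground_finite.subset hC.subset_ground
  obtain ⟨k, hk⟩ := eRk_eq_nat_of_subset M hXE
  have hA : k + 2 ≤ X.ncard := eRk_union_add_two_le_of_circuits M h₁ h₂ hne hk
  -- `X ∩ C ⊂ C` is independent
  have hI : X ∩ C ⊂ C := ⟨inter_subset_right, fun h => hnot (fun x hx => (h hx).1)⟩
  have hind : M.Indep (X ∩ C) := hC.ssubset_indep hI
  have hsub := M.eRk_inter_add_eRk_union_le X C
  have eC := hC.eRk_add_one_eq
  obtain ⟨r, hr⟩ := eRk_eq_nat_of_subset M hC.subset_ground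
  rw [hr, ← hfC.cast_ncard_eq] at eC
  rw [hind.eRk_eq_encard, hk, hr, ← (hfX.subset inter_subset_left).cast_ncard_eq] at hsub
  obtain ⟨m, hm⟩ := eRk_eq_nat_of_subset M (union_subset hXE hC.subset_ground)
  rw [hm] at hsub
  -- the nullity cap on `X ∪ C`
  have hcap := Matroid.encard_le_eRk_add_of_encard_eq (M := M) (union_subset hXE hC.subset_ground) hd
  rw [hm, ← (hfX.union hfC).cast_ncard_eq] at hcap
  have hu := ncard_union_add_ncard_inter X C hfX hfC
  have eC' : r + 1 = C.ncard := by exact_mod_cast eC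
  have hsub' : (X ∩ C).ncard + m ≤ k + r := by exact_mod_cast hsub
  have hcap' : (X ∪ C).ncard ≤ m + 2 := by exact_mod_cast hcap
  omega

/-- The 4-circuits of a finite matroid form a finite set. -/
theorem fourCircuits_finite (M : Matroid α) [M.Finite] :
    {C : Set α | M.IsCircuit C ∧ C.ncard = 4}.Finite :=
  M.ground_finite.finite_subsets.subset (fun _ hC => hC.1.subset_ground)

/-- **The pairwise-small case**: if every two distinct 4-circuits share at most two points, a nullity-`2` matroid has at
most three 4-circuits (a fourth would lie in `(C₁ ∩ C₂) ∪ (C₁ ∩ C₃) ∪ (C₂ ∩ C₃)` and miss every pairwise intersection). -/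
theorem ncard_fourCircuits_le_three_of_pairwise (M : Matroid α) [M.Finite] (hd : M.E.encard = M.eRank + 2)
    (hpair : ∀ C C' : Set α, M.IsCircuit C → C.ncard = 4 → M.IsCircuit C' → C'.ncard = 4 → C ≠ C' →
      (C ∩ C').ncard ≤ 2) :
    {C : Set α | M.IsCircuit C ∧ C.ncard = 4}.ncard ≤ 3 := by
  by_contra hlt
  have hlt' : 3 < {C : Set α | M.IsCircuit C ∧ C.ncard = 4}.ncard := by omega
  have hfin := fourCircuits_finite M
  obtain ⟨C₁, C₂, C₃, h₁, h₂, h₃, h12, h13, h23⟩ := (Set.two_lt_ncard_iff hfin).1 (by omega)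
  -- every quad is one of the three
  have hsub : {C : Set α | M.IsCircuit C ∧ C.ncard = 4} ⊆ {C₁, C₂, C₃} := by
    intro C hC
    by_contra hnot
    simp only [mem_insert_iff, mem_singleton_iff, not_or] at hnot
    obtain ⟨hn1, hn2, hn3⟩ := hnot
    have hfC : C.Finite := M.ground_finite.subset hC.1.subset_ground
    have s12 := circuit_subset_union_of_nullity_two M hd h₁.1 h₂.1 h12 hC.1
    have s13 := circuit_subset_union_of_nullity_two M hd h₁.1 h₃.1 h13 hC.1
    have s23 := circuit_subset_union_of_nullity_two M hd h₂.1 h₃.1 h23 hC.1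
    -- the triple intersections with `C` are empty
    have key : ∀ A B : Set α, M.IsCircuit A → A.ncard = 4 → M.IsCircuit B → B.ncard = 4 → C ≠ A → C ≠ B →
        C ⊆ A ∪ B → C ∩ A ∩ B = ∅ := by
      intro A B hA hA4 hB hB4 hCA hCB hCAB
      have hfA : A.Finite := M.ground_finite.subset hA.subset_ground
      have hfB : B.Finite := M.ground_finite.subset hB.subset_ground
      have e1 : (C ∩ A) ∪ (C ∩ B) = C := by
        rw [← inter_union_distrib_left]; exact inter_eq_left.2 hCAB
      have e2 : (C ∩ A) ∩ (C ∩ B) = C ∩ A ∩ B := by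
        ext x; simp only [mem_inter_iff]; tauto
      have hu := ncard_union_add_ncard_inter (C ∩ A) (C ∩ B) (hfC.subset inter_subset_left)
        (hfC.subset inter_subset_left)
      rw [e1, e2, hC.2] at hu
      have hA2 := hpair C A hC.1 hC.2 hA hA4 hCA
      have hB2 := hpair C B hC.1 hC.2 hB hB4 hCB
      have h0 : (C ∩ A ∩ B).ncard = 0 := by omega
      exact (Set.ncard_eq_zero (hfC.subset (inter_subset_left.trans inter_subset_left))).1 h0
    have k12 := key C₁ C₂ h₁.1 h₁.2 h₂.1 h₂.2 hn1 hn2 s12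
    have k13 := key C₁ C₃ h₁.1 h₁.2 h₃.1 h₃.2 hn1 hn3 s13
    have k23 := key C₂ C₃ h₂.1 h₂.2 h₃.1 h₃.2 hn2 hn3 s23
    -- but `C` is nonempty
    have hne : C.Nonempty := by
      rw [← Set.ncard_pos hfC, hC.2]; norm_num
    obtain ⟨x, hx⟩ := hne
    have m12 := s12 hx
    have m13 := s13 hx
    have m23 := s23 hx
    simp only [mem_union] at m12 m13 m23
    have e12 : x ∉ C ∩ C₁ ∩ C₂ := by rw [k12]; exact notMem_empty x
    have e13 : x ∉ C ∩ C₁ ∩ C₃ := by rw [k13]; exact notMem_empty x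
    have e23 : x ∉ C ∩ C₂ ∩ C₃ := by rw [k23]; exact notMem_empty x
    simp only [mem_inter_iff, not_and] at e12 e13 e23
    tauto
  have h3 : ({C₁, C₂, C₃} : Set (Set α)).ncard ≤ 3 := by
    refine (Set.ncard_insert_le _ _).trans ?_
    refine Nat.succ_le_succ ((Set.ncard_insert_le _ _).trans ?_)
    simp
  have h4 : {C : Set α | M.IsCircuit C ∧ C.ncard = 4}.ncard ≤ 3 := (Set.ncard_le_ncard hsub (by simp)).trans h3
  omega

/-- The pair rank of a core: two distinct points have rank `2` (no loops, no parallel pairs). -/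
theorem eRk_pair_eq_two_of_free (M : Matroid α) [M.Finite]
    (hfree : ∀ e ∈ M.E, ∃ A ⊆ M.E \ {e}, e ∉ M.closure A ∧ e ∉ M.closure ((M.E \ {e}) \ A)) :
    ∀ e ∈ M.E, ∀ f ∈ M.E, e ≠ f → M.eRk {e, f} = 2 := by
  intro e he f hf hef
  have h2 : (2 : ℕ∞) ≤ M.eRk {e, f} :=
    two_le_eRk_of_two_le_ncard_of_free M hfree (pair_subset he hf) (by rw [ncard_pair hef])
  have h3 : M.eRk {e, f} ≤ 2 := by
    have := M.eRk_le_encard {e, f}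
    rwa [encard_pair hef] at this
  exact le_antisymm h3 h2

/-- **L1 — at nullity `2`, four 4-circuits force a `U₃,₅`**: a 5-set `P ⊆ E` whose 4-subsets are all circuits, containing
every 4-circuit (two quads share three points — else at most three quads —, their union carries every circuit, and a
4-subset of the union that is not a circuit would contain a triangle, leaving at most three quads). -/
theorem exists_five_of_four_le_ncard_fourCircuits (M : Matroid α) [M.Finite]
    (hfree : ∀ e ∈ M.E, ∃ A ⊆ M.E \ {e}, e ∉ M.closure A ∧ e ∉ M.closure ((M.E \ {e}) \ A))
    (hd : M.E.encard = M.eRank + 2) (h4 : 4 ≤ {C : Set α | M.IsCircuit C ∧ C.ncard = 4}.ncard) :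
    ∃ P ⊆ M.E, P.ncard = 5 ∧ (∀ S ⊆ P, S.ncard = 4 → M.IsCircuit S) ∧
      ∀ C, M.IsCircuit C → C.ncard = 4 → C ⊆ P := by
  -- two quads sharing three points
  have hex : ∃ C₁ C₂ : Set α, M.IsCircuit C₁ ∧ C₁.ncard = 4 ∧ M.IsCircuit C₂ ∧ C₂.ncard = 4 ∧ C₁ ≠ C₂ ∧
      3 ≤ (C₁ ∩ C₂).ncard := by
    by_contra hnot
    have hpair : ∀ C C' : Set α, M.IsCircuit C → C.ncard = 4 → M.IsCircuit C' → C'.ncard = 4 → C ≠ C' →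
        (C ∩ C').ncard ≤ 2 := by
      intro C C' hC hC4 hC' hC'4 hne
      by_contra h
      exact hnot ⟨C, C', hC, hC4, hC', hC'4, hne, by omega⟩
    have := ncard_fourCircuits_le_three_of_pairwise M hd hpair
    omega
  obtain ⟨C₁, C₂, h₁, h₁4, h₂, h₂4, hne, h3⟩ := hex
  have hf₁ : C₁.Finite := M.ground_finite.subset h₁.subset_ground
  have hf₂ : C₂.Finite := M.ground_finite.subset h₂.subset_ground
  have hI3 : (C₁ ∩ C₂).ncard = 3 := by
    have hlt : (C₁ ∩ C₂).ncard < C₁.ncard := Set.ncard_lt_ncard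
      ⟨inter_subset_left, fun h => hne (h₁.eq_of_subset_isCircuit h₂ (fun x hx => (h hx).2))⟩ hf₁
    omega
  have hu := ncard_union_add_ncard_inter C₁ C₂ hf₁ hf₂
  have hP5 : (C₁ ∪ C₂).ncard = 5 := by omega
  have hPE : C₁ ∪ C₂ ⊆ M.E := union_subset h₁.subset_ground h₂.subset_ground
  have hfP : (C₁ ∪ C₂).Finite := hf₁.union hf₂
  refine ⟨C₁ ∪ C₂, hPE, hP5, ?_, fun C hC _ => circuit_subset_union_of_nullity_two M hd h₁ h₂ hne hC⟩
  intro S hS hS4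
  by_contra hnotS
  -- `S` is dependent: `r(S) ≤ r(P) ≤ 3 < 4`
  obtain ⟨k, hk⟩ := eRk_eq_nat_of_subset M hPE
  have hk3 : k ≤ 3 := by
    have := eRk_union_add_two_le_of_circuits M h₁ h₂ hne hk
    omega
  have hSE : S ⊆ M.E := hS.trans hPE
  have hfS : S.Finite := M.ground_finite.subset hSE
  have hdep : M.Dep S := by
    rw [Matroid.dep_iff]
    refine ⟨fun hind => ?_, hSE⟩
    have h1 := hind.eRk_eq_encard
    have h2 : M.eRk S ≤ M.eRk (C₁ ∪ C₂) := M.eRk_mono hS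
    rw [h1, hk, ← hfS.cast_ncard_eq, hS4] at h2
    have : (4 : ℕ) ≤ k := by exact_mod_cast h2
    omega
  obtain ⟨D, hDS, hD⟩ := hdep.exists_isCircuit_subset
  have hDne : D ≠ S := fun h => hnotS (h ▸ hD)
  have hDlt : D ⊂ S := ⟨hDS, fun h => hDne (subset_antisymm hDS h)⟩
  have hD3 : D.ncard = 3 := by
    have hlt := Set.ncard_lt_ncard hDlt hfS
    have hL : ∀ e ∈ M.E, ¬ M.IsLoop e := not_isLoop_of_free M hfree
    have h3' := three_le_encard_of_circuit M hL (eRk_pair_eq_two_of_free M hfree) D hD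
    rw [← (hfS.subset hDS).cast_ncard_eq] at h3'
    have : 3 ≤ D.ncard := by exact_mod_cast h3'
    omega
  -- every quad is `P ∖ {x}` for some `x ∈ D`
  have hsub : {C : Set α | M.IsCircuit C ∧ C.ncard = 4} ⊆ (fun x => (C₁ ∪ C₂) \ {x}) '' D := by
    intro C hC
    have hC4 : C.ncard = 4 := hC.2
    have hCP : C ⊆ C₁ ∪ C₂ := circuit_subset_union_of_nullity_two M hd h₁ h₂ hne hC.1
    have hnotDC : ¬ D ⊆ C := fun hDC => hC.1.not_ssubset hD ⟨hDC, fun hCD => by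
      have := Set.ncard_le_ncard hCD (hfS.subset hDS)
      omega⟩
    obtain ⟨x, hxD, hxC⟩ := not_subset.1 hnotDC
    refine ⟨x, hxD, ?_⟩
    have hCsub : C ⊆ (C₁ ∪ C₂) \ {x} := fun y hy => ⟨hCP hy, fun h => hxC (mem_singleton_iff.1 h ▸ hy)⟩
    have hx : x ∈ C₁ ∪ C₂ := hS (hDS hxD)
    have hcard : ((C₁ ∪ C₂) \ {x}).ncard = 4 := by
      rw [Set.ncard_sdiff_singleton_of_mem hx, hP5]
    exact (Set.eq_of_subset_of_ncard_le hCsub (by rw [hcard, hC.2]) (hfP.sdiff)).symm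
  have h1 := Set.ncard_le_ncard hsub ((hfS.subset hDS).image _)
  have h2 : ((fun x => (C₁ ∪ C₂) \ {x}) '' D).ncard ≤ 3 := by
    have := Set.ncard_image_le (s := D) (f := fun x => (C₁ ∪ C₂) \ {x}) (hfS.subset hDS)
    omega
  omega

end ThmN

end PercRepro
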